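import Summits.ResolutionOfSingularities.ResolutionOfSingularities.Theorems.HilbertSamuelEliminationSigmaMaxModificationsCorridor3WLadderIsoInsepE2NearCubicTower
import Summits.ResolutionOfSingularities.ResolutionOfSingularities.Theorems.HilbertSamuelEliminationSigmaMaxModificationsCorridor3WLadderIsoInsepE2NearSymbolic
import Summits.ResolutionOfSingularities.ResolutionOfSingularities.Theorems.HilbertSamuelEliminationSigmaMaxModificationsCorridor3WLadderIsoInsepE2NearLinePrime
import Summits.ResolutionOfSingularities.ResolutionOfSingularities.Theorems.HilbertSamuelEliminationSigmaMaxModificationsCorridor3WLadderIsoInsepE2NearGenerization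
import HarnessLib

/-!
# [OURS · L1 W4.2] E2 chart calculus, brick 16: THE NEXT POINT AS A PRIME `(P)` OF `κ[X]` ON THE LINE, AND **RC IN THE CHART** —
# after an E2 stage of an isolated E3 point tower over a maximal origin of characteristic two the next point is RATIONAL over
# `κ(x_n)` (`deg P = 1`) (crux chain w42, cell k2 `T3insep` = `stub_isoInsepTower`; `--supports stmt-ResolutionOfSingularities-19249`)

OURS (cell res-hironaka, slot W4.2, seat res-D-pv-042; OWN OBJECT TUO 18:19Z, (N3) continuation); NOT a statement of [Hironaka2017]
nor of [CossartJannsenSaito2020] / [CossartPiltant2008]. AI-drafted, weaker than expert review. PROOF file, def-free, fact-free.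

* `natDegree_aeval_le_of_isHomogeneous` — substituting polynomials of degree `≤ 1` into a form of degree `n` gives degree `≤ n`.
* `ringKrullDim_eq_four_of_surjective_of_ker_eq` — `dim L = 4` for a regular local `L` with `L/(h) ≅ S`, `h ≠ 0`, `dim S = 3`.
* `exists_e2StepPresentation_rational` — brick 12 `exists_e2StepPresentation_cubic` + brick 14 (the reduction `π : R[𝔪/c_j] ↠ κ[T]`,
  `𝔭 = π(𝔔)`, **`π(F(c/c_j)) ∈ 𝔭 ∩ 𝔭⁽²⁾`** — nearness and `ē = 3` at the next point) + brick 15 (the surviving variable `kc`, the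
  other two in `𝔭`, `𝔭 ∩ κ[T_{kc}] = (P)`, **`P ∣ g`, `P² ∣ g`** for `g = ` the restricted cubic as a polynomial in `X = T_{kc}`,
  `deg g ≤ 3`) + brick 17a (if `g = 0` the strict transform lies in `𝔮²` for the prime `𝔮 = (u, v, c_j)` of the exceptional line,
  `𝔮B_𝔔 ≠ 𝔪` by `emb.dim B_𝔔 = 4`, and the next point would NOT be isolated in the Hilbert–Samuel locus of `X_{n+1}` — against the
  tower hypothesis) ⇒ **`g ≠ 0` and `deg P = 1`**: the next point is rational over `κ(x_n)` (the RC row, chart form).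
-/

noncomputable section

set_option linter.dupNamespace false

open scoped Classical
open CategoryTheory AlgebraicGeometry TopologicalSpace IsLocalRing MvPolynomial
open Literature.RingTheory.HilbertSamuel Literature.AlgebraicGeometry.Resolution Literature.AlgebraicGeometry.CossartJannsenSaito2020
open Summit.ResolutionOfSingularities.ResolutionOfSingularities.Theorems.CampaignW42
open Summit.ResolutionOfSingularities.ResolutionOfSingularities.Theorems.SigmaMaxModificationsCorridor3
open Summit.ResolutionOfSingularities.ResolutionOfSingularities.Theorems.SigmaMaxModificationsCorridor3.Moving (exists_towerStructure)
open Summit.ResolutionOfSingularities.ResolutionOfSingularities.Cruxes.SigmaMaxModifications.IdeasL1Idea2R4 (IsIsoPointTower)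
open Summit.ResolutionOfSingularities.ResolutionOfSingularities.Cruxes.SigmaMaxModifications.IdeasL1C5 (IsInsepStage)

namespace Summit.ResolutionOfSingularities.ResolutionOfSingularities.Cruxes.SigmaMaxModifications.IdeasL1C6

universe u v

/-- **Substituting polynomials of degree `≤ 1` into a form of degree `n` gives a polynomial of degree `≤ n`.** [folklore] -/
theorem natDegree_aeval_le_of_isHomogeneous {K : Type u} [CommRing K] {σ : Type v} {F : MvPolynomial σ K} {n : ℕ}
    (hF : F.IsHomogeneous n) (φ : σ → Polynomial K) (hφ : ∀ k, (φ k).natDegree ≤ 1) :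
    (MvPolynomial.aeval φ F).natDegree ≤ n := by
  rw [MvPolynomial.aeval_def, MvPolynomial.eval₂_eq]
  refine Polynomial.natDegree_sum_le_of_forall_le _ _ fun d hd => ?_
  refine (Polynomial.natDegree_mul_le).trans ?_
  have hC : ((algebraMap K (Polynomial K)) (coeff d F)).natDegree = 0 := by
    rw [Polynomial.algebraMap_eq]; exact Polynomial.natDegree_C _
  rw [hC, zero_add]
  refine (Polynomial.natDegree_prod_le _ _).trans ?_
  rw [hF.degree_eq_sum_deg_support hd]
  refine Finset.sum_le_sum fun i _ => ?_
  refine (Polynomial.natDegree_pow_le).trans ?_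
  calc d i * (φ i).natDegree ≤ d i * 1 := Nat.mul_le_mul_left _ (hφ i)
    _ = d i := mul_one _

/-- If `σ : L ↠ S` has kernel `(h)` with `h` a non-zero element of the maximal ideal of the noetherian local domain `L` and
`dim S = 3`, then `dim L = 4` (Krull's principal ideal theorem, `ringKrullDim (L ⧸ (h)) + 1 = ringKrullDim L`; stated for a
regular local `L`, the case of use).
[OURS · L1 W4.2 · k2 · E2 chart calculus, brick 16] [folklore] -/
theorem ringKrullDim_eq_four_of_surjective_of_ker_eq {L : Type u} {S : Type v} [CommRing L] [IsRegularLocalRing L]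
    [CommRing S] (σ : L →+* S) (hσ : Function.Surjective σ) {h : L} (hker : RingHom.ker σ = Ideal.span {h})
    (h0 : h ≠ 0) (h𝔪 : h ∈ maximalIdeal L) (h3 : ringKrullDim S = (3 : ℕ)) : ringKrullDim L = (4 : ℕ) := by
  haveI := isDomain_of_isRegularLocalRing L
  let e : (L ⧸ Ideal.span {h}) ≃+* S := (Ideal.quotEquivOfEq hker).symm.trans (RingHom.quotientKerEquivOfSurjective hσ)
  have h1 : ringKrullDim (L ⧸ Ideal.span {h}) = (3 : ℕ) := by rw [ringKrullDim_eq_of_ringEquiv e, h3]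
  have h2 := ringKrullDim_quotient_span_singleton_succ_eq_ringKrullDim_of_mem_nonZeroDivisors
    (mem_nonZeroDivisors_of_ne_zero h0) h𝔪
  rw [h1] at h2
  rw [← h2]
  rfl

/-- **THE NEXT POINT AS A PRIME `(P)` ON THE LINE; RC IN THE CHART.** Along an isolated E3 point tower over a maximal origin of
characteristic two, at an E2 stage `n`: the data of brick 12 (`exists_e2StepPresentation_cubic`) together with the reduction
`π : R[𝔪/c_j] ↠ κ[T_k : k ≠ j]` (`π|_R` = residue, `π(c_k/c_j) = T_k`, `ker π = (c_j)`), the prime `𝔭 = π(𝔔)` of the next point with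
`T_{k} ∈ 𝔭` for the two indices `k ∈ {0,1}`, the surviving variable `kc ∉ {0, 1, j}` and a generator `P` of `𝔭 ∩ κ[T_{kc}]`; the reduced
cubic `π(F(c/c_j))` lies in `𝔭` (nearness, brick 11) AND in `𝔭²κ[T]_𝔭` (`ē = 3` at the next point, bricks 13–14), so `P ∣ g` and
`P² ∣ g` for its restriction `g` to the line (brick 15, `deg g ≤ 3`); and **`g ≠ 0`** (brick 17a: otherwise the strict transform is
singular along the whole exceptional line and `x_{n+1}` is not isolated in the Hilbert–Samuel locus), hence **`deg P = 1`**: the next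
point is RATIONAL over `κ(x_n)`. [OURS · L1 W4.2 · k2 · E2 chart calculus, brick 16] [folklore] -/
theorem exists_e2StepPresentation_rational {N : ℕ} {ν : ℕ → ℕ} {T : BlowupTower.{0}} {pt : ∀ n, T.X n}
    (hO : IsMaximalOrigin 2 N ν (T.X 0) (pt 0)) (hT : IsIsoPointTower N ν T pt) (n : ℕ) (hE : IsE2Stage T pt n) :
    ∃ (R : Type) (_ : CommRing R) (_ : IsRegularLocalRing R) (c : Fin 4 → R) (σ : R →+* (T.X n).presheaf.stalk (pt n))
      (h cc lam : R) (hpt : (T.π n) (pt (n + 1)) = pt n),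
      (maximalIdeal R).spanFinrank = 4 ∧ Ideal.span (Set.range c) = maximalIdeal R ∧ Function.Surjective σ ∧
      RingHom.ker σ = Ideal.span {h} ∧ h ∈ maximalIdeal R ^ 2 ∧ h ∉ maximalIdeal R ^ 3 ∧
      cc ∉ maximalIdeal R ∧ (∀ u : R, u ^ 2 - lam ∉ maximalIdeal R) ∧
      h - cc * (c 0 ^ 2 + lam * c 1 ^ 2) ∈ maximalIdeal R ^ 3 ∧ (2 : R) ∈ maximalIdeal R ∧
    ∃ (j : Fin 4) (𝔔 : PrimeSpectrum (blowupAlgebra (Ideal.span (Set.range c)) (c j)))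
      (h' : blowupAlgebra (Ideal.span (Set.range c)) (c j))
      (σ' : Localization.AtPrime 𝔔.asIdeal →+* (T.X (n + 1)).presheaf.stalk (pt (n + 1))),
      algebraMap R _ h = algebraMap R _ (c j) ^ 2 * h' ∧
      Prime (algebraMap R (blowupAlgebra (Ideal.span (Set.range c)) (c j)) (c j)) ∧
      ¬ algebraMap R (blowupAlgebra (Ideal.span (Set.range c)) (c j)) (c j) ∣ h' ∧
      𝔔.asIdeal.comap (algebraMap R _) = maximalIdeal R ∧
      h' ∈ 𝔔.asIdeal ∧
      IsRegularLocalRing (Localization.AtPrime 𝔔.asIdeal) ∧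
      Function.Surjective σ' ∧
      RingHom.ker σ' = Ideal.span {algebraMap _ (Localization.AtPrime 𝔔.asIdeal) h'} ∧
      (∀ r : R, σ' (algebraMap _ (Localization.AtPrime 𝔔.asIdeal)
        (algebraMap R (blowupAlgebra (Ideal.span (Set.range c)) (c j)) r)) =
          ((T.π n).stalkMap (pt (n + 1))).hom (((T.X n).presheaf.stalkCongr (.of_eq hpt)).inv (σ r))) ∧
      (∀ k : Fin 4, σ' (algebraMap _ (Localization.AtPrime 𝔔.asIdeal) (blowupAlgebra.frac c j k)) *
        ((T.π n).stalkMap (pt (n + 1))).hom (((T.X n).presheaf.stalkCongr (.of_eq hpt)).inv (σ (c j))) =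
          ((T.π n).stalkMap (pt (n + 1))).hom (((T.X n).presheaf.stalkCongr (.of_eq hpt)).inv (σ (c k)))) ∧
      ((T.π n).stalkMap (pt (n + 1))).hom (((T.X n).presheaf.stalkCongr (.of_eq hpt)).inv (σ (c j))) ∈
        nonZeroDivisors ((T.X (n + 1)).presheaf.stalk (pt (n + 1))) ∧
      stalkIdeal ((T.centreIdeal n).comap (T.π n)) (pt (n + 1)) =
        Ideal.span {((T.π n).stalkMap (pt (n + 1))).hom
          (((T.X n).presheaf.stalkCongr (.of_eq hpt)).inv (σ (c j)))} ∧
      algebraMap _ (Localization.AtPrime 𝔔.asIdeal) h' ∈ maximalIdeal (Localization.AtPrime 𝔔.asIdeal) ^ 2 ∧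
      algebraMap _ (Localization.AtPrime 𝔔.asIdeal) h' ∉ maximalIdeal (Localization.AtPrime 𝔔.asIdeal) ^ 3 ∧
      blowupAlgebra.frac c j 0 ∈ 𝔔.asIdeal ∧ blowupAlgebra.frac c j 1 ∈ 𝔔.asIdeal ∧ j ≠ 0 ∧ j ≠ 1 ∧
    ∃ F : MvPolynomial (Fin 4) R, F.IsHomogeneous 3 ∧ MvPolynomial.eval c F = h - cc * (c 0 ^ 2 + lam * c 1 ^ 2) ∧
      h' = algebraMap R _ cc * (blowupAlgebra.frac c j 0 ^ 2 + algebraMap R _ lam * blowupAlgebra.frac c j 1 ^ 2) +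
        algebraMap R _ (c j) * MvPolynomial.aeval (blowupAlgebra.frac c j) F ∧
      MvPolynomial.aeval (blowupAlgebra.frac c j) F ∈ 𝔔.asIdeal ∧
      MvPolynomial.aeval (fun k => if k = 0 ∨ k = 1 then 0 else blowupAlgebra.frac c j k) F ∈ 𝔔.asIdeal ∧
    ∃ (π : blowupAlgebra (Ideal.span (Set.range c)) (c j) →+* MvPolynomial {k : Fin 4 // k ≠ j} (ResidueField R))
      (𝔭 : Ideal (MvPolynomial {k : Fin 4 // k ≠ j} (ResidueField R))) (_ : 𝔭.IsPrime) (kc : {k : Fin 4 // k ≠ j}) (P : Polynomial (ResidueField R)),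
      Function.Surjective π ∧
      (∀ a : R, π (algebraMap R _ a) = MvPolynomial.C (residue R a)) ∧
      (∀ (k : Fin 4) (hk : k ≠ j), π (blowupAlgebra.frac c j k) = MvPolynomial.X ⟨k, hk⟩) ∧
      RingHom.ker π = Ideal.span {algebraMap R _ (c j)} ∧ 𝔭 = 𝔔.asIdeal.map π ∧ 𝔭.comap π = 𝔔.asIdeal ∧
      (kc.1 ≠ 0 ∧ kc.1 ≠ 1) ∧ (∀ k : {k : Fin 4 // k ≠ j}, k ≠ kc → (MvPolynomial.X k : MvPolynomial {k : Fin 4 // k ≠ j} (ResidueField R)) ∈ 𝔭) ∧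
      𝔭.comap (Polynomial.aeval (MvPolynomial.X kc : MvPolynomial {k : Fin 4 // k ≠ j} (ResidueField R))) = Ideal.span {P} ∧
      π (MvPolynomial.aeval (blowupAlgebra.frac c j) F) ∈ 𝔭 ∧
      algebraMap (MvPolynomial {k : Fin 4 // k ≠ j} (ResidueField R)) (Localization.AtPrime 𝔭) (π (MvPolynomial.aeval (blowupAlgebra.frac c j) F)) ∈
        maximalIdeal (Localization.AtPrime 𝔭) ^ 2 ∧
      P ∣ MvPolynomial.aeval (fun k : {k : Fin 4 // k ≠ j} => if k = kc then (Polynomial.X : Polynomial (ResidueField R)) else 0)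
        (π (MvPolynomial.aeval (blowupAlgebra.frac c j) F)) ∧
      P ^ 2 ∣ MvPolynomial.aeval (fun k : {k : Fin 4 // k ≠ j} => if k = kc then (Polynomial.X : Polynomial (ResidueField R)) else 0)
        (π (MvPolynomial.aeval (blowupAlgebra.frac c j) F)) ∧
      MvPolynomial.aeval (fun k : {k : Fin 4 // k ≠ j} => if k = kc then (Polynomial.X : Polynomial (ResidueField R)) else 0)
          (π (MvPolynomial.aeval (blowupAlgebra.frac c j) F)) ≠ 0 ∧
      P.natDegree = 1
 := by
  obtain ⟨R, _, _, c, σ, h, cc, lam, hpt, h4, hc, hσ, hker, hh2, hh3, hcc, hlam, hshape, h2, j, 𝔔, h', σ', hh', hprime, hndvd,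
    h𝔔, hh'𝔔, hreg, hσ', hker', hcompat, hfrac, hnzd, hcentre, hh'2, hh'3, hfr0, hfr1, hj0, hj1, F, hF, hFh, heq, hG, hG0⟩ :=
    exists_e2StepPresentation_cubic hO hT n hE
  haveI := hreg
  haveI : IsLocallyNoetherian (T.X (n + 1)) := T.ln (n + 1)
  -- residue characteristic two and `ē = 3`, `dim = 3` at the next point
  obtain ⟨k₀, _, _, f₀, hsep, hft, hqc⟩ := hO.exists_structure
  haveI := hsep
  haveI := hft
  haveI := hqc
  obtain ⟨f, -, -, -⟩ := exists_towerStructure T f₀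
  obtain ⟨φ⟩ := exists_ringHom_field_stalk (f (n + 1)) (pt (n + 1))
  haveI : CharP (ResidueField ((T.X (n + 1)).presheaf.stalk (pt (n + 1)))) 2 :=
    charP_of_injective_ringHom ((residue _).comp φ).injective 2
  have hdp' : IsFormalDoublePointAt (T.X (n + 1)) (pt (n + 1)) := isFormalDoublePointAt_succ_of_isIsoPointTower hO hT n hE.2.1
  have hdim3 : ringKrullDim ((T.X (n + 1)).presheaf.stalk (pt (n + 1))) = (3 : ℕ) :=
    ringKrullDim_stalk_eq_three_of_isFormalDoublePointAt hdp'
  have hgeom : Scheme.geomDirDim (T.X (n + 1)) (pt (n + 1)) + 1 = 4 := by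
    have h3 : 3 ≤ Scheme.geomDirDim (T.X (n + 1)) (pt (n + 1)) := hT.2.2.2.2.2 (n + 1)
    have hle : (Scheme.geomDirDim (T.X (n + 1)) (pt (n + 1)) : WithBot ℕ∞) ≤
        ringKrullDim ((T.X (n + 1)).presheaf.stalk (pt (n + 1))) := geomDirDim_le_ringKrullDim _
    rw [hdim3] at hle
    have hle' : Scheme.geomDirDim (T.X (n + 1)) (pt (n + 1)) ≤ 3 := by exact_mod_cast hle
    omega
  -- `emb.dim B_𝔔 = 4`
  haveI hregL : IsRegularLocalRing (Localization.AtPrime 𝔔.asIdeal) := inferInstance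
  have hL4 : ringKrullDim (Localization.AtPrime 𝔔.asIdeal) = (4 : ℕ) := by
    have h0 : algebraMap (blowupAlgebra (Ideal.span (Set.range c)) (c j)) (Localization.AtPrime 𝔔.asIdeal) h' ≠ 0 := fun h0 =>
      hh'3 (by rw [h0]; exact Submodule.zero_mem _)
    have h𝔪 : algebraMap (blowupAlgebra (Ideal.span (Set.range c)) (c j)) (Localization.AtPrime 𝔔.asIdeal) h' ∈
        maximalIdeal (Localization.AtPrime 𝔔.asIdeal) := Ideal.pow_le_self two_ne_zero hh'2
    exact @ringKrullDim_eq_four_of_surjective_of_ker_eq (Localization.AtPrime 𝔔.asIdeal) _ _ hregL _ σ' hσ' _ hker' h0 h𝔪 hdim3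
  have hd' : (maximalIdeal (Localization.AtPrime 𝔔.asIdeal)).spanFinrank = 4 := by
    have := hregL.spanFinrank_maximalIdeal
    rw [hL4] at this
    exact_mod_cast this
  -- brick 14: the reduction and the symbolic square
  obtain ⟨π, 𝔭, h𝔭p, hπsurj, hπalg, hπfrac, hπcj, hkerπ, h𝔭, hcomap, hX0, hX1, hπG𝔭, hπG, hsym⟩ :=
    E2Chart.reduction_coneTransform_mem_maximalIdeal_sq h4 c hc hF hFh j 𝔔.asIdeal h𝔔 hfr0 hfr1 hh' σ' hσ' hker' hh'2 hh'3
      hd' hgeom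
  haveI := h𝔭p
  -- the surviving variable `kc = 5 − j ∈ {2, 3}`
  have hjv : j.val = 2 ∨ j.val = 3 := by
    have h0 : j.val ≠ 0 := fun h => hj0 (Fin.ext h)
    have h1 : j.val ≠ 1 := fun h => hj1 (Fin.ext h)
    have := j.isLt
    omega
  have hkcj : (⟨5 - j.val, by omega⟩ : Fin 4) ≠ j := by
    intro h
    have := congrArg Fin.val h
    simp only at this
    omega
  obtain ⟨kc, hkcval⟩ : ∃ kc : {k : Fin 4 // k ≠ j}, kc.1.val = 5 - j.val := ⟨⟨⟨5 - j.val, by omega⟩, hkcj⟩, rfl⟩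
  have hkc0 : kc.1 ≠ 0 := by
    intro h; have := congrArg Fin.val h; rw [hkcval] at this; simp only [Fin.val_zero] at this; omega
  have hkc1 : kc.1 ≠ 1 := by
    intro h; have := congrArg Fin.val h; rw [hkcval] at this; simp only [Fin.val_one] at this; omega
  have hvars : ∀ k : {k : Fin 4 // k ≠ j}, k ≠ kc →
      (MvPolynomial.X k : _root_.MvPolynomial {k : Fin 4 // k ≠ j} (ResidueField R)) ∈ 𝔭 := by
    intro k hk
    have hkv : k.1.val ≠ 5 - j.val := fun h => hk (Subtype.ext (Fin.ext (by rw [hkcval]; exact h)))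
    have hkj' : k.1.val ≠ j.val := fun h => k.2 (Fin.ext h)
    have hlt := k.1.isLt
    have hk01 : k.1.val = 0 ∨ k.1.val = 1 := by omega
    rcases hk01 with h0 | h1
    · have hk0 : k = ⟨0, fun h => hj0 h.symm⟩ := Subtype.ext (Fin.ext h0)
      rw [hk0, ← hπfrac 0 (fun h => hj0 h.symm)]; exact hX0
    · have hk1 : k = ⟨1, fun h => hj1 h.symm⟩ := Subtype.ext (Fin.ext h1)
      rw [hk1, ← hπfrac 1 (fun h => hj1 h.symm)]; exact hX1
  -- the generator of `𝔭 ∩ κ[T_{kc}]`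
  obtain ⟨P, hP⟩ : ∃ P : Polynomial (ResidueField R),
      𝔭.comap (Polynomial.aeval (MvPolynomial.X kc : _root_.MvPolynomial {k : Fin 4 // k ≠ j} (ResidueField R))) = Ideal.span {P} :=
    ⟨_, (Submodule.IsPrincipal.span_singleton_generator _).symm⟩
  have hdiv1 := E2Chart.generator_dvd_lineRestriction kc 𝔭 hvars hP hπG𝔭
  have hdiv2 := E2Chart.generator_sq_dvd_lineRestriction kc 𝔭 hvars hP hsym
  -- the degree count
  have hdeg3 : (MvPolynomial.aeval (fun k : {k : Fin 4 // k ≠ j} => if k = kc then (Polynomial.X : Polynomial (ResidueField R)) else 0)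
      (π (MvPolynomial.aeval (blowupAlgebra.frac c j) F))).natDegree ≤ 3 := by
    rw [hπG, ← AlgHom.comp_apply, MvPolynomial.comp_aeval]
    refine natDegree_aeval_le_of_isHomogeneous (hF.map (residue R)) _ fun k => ?_
    by_cases hk : k = j
    · subst hk; simp
    · simp only [hk, dite_false, MvPolynomial.aeval_X]
      split_ifs
      · exact Polynomial.natDegree_X_le
      · simp
  -- (N3c) the branch `g = 0` is impossible: the strict transform would be singular along the whole exceptional line
  have hg0 : MvPolynomial.aeval (fun k : {k : Fin 4 // k ≠ j} => if k = kc then (Polynomial.X : Polynomial (ResidueField R)) else 0)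
      (π (MvPolynomial.aeval (blowupAlgebra.frac c j) F)) ≠ 0 := by
    intro h0
    -- the two killed indices `0, 1`
    have ha : (⟨0, fun h => hj0 h.symm⟩ : {k : Fin 4 // k ≠ j}) ≠ kc := fun h => hkc0 (congrArg Subtype.val h).symm
    have hb : (⟨1, fun h => hj1 h.symm⟩ : {k : Fin 4 // k ≠ j}) ≠ kc := fun h => hkc1 (congrArg Subtype.val h).symm
    have hab : ∀ k : {k : Fin 4 // k ≠ j}, k ≠ kc →
        k = ⟨0, fun h => hj0 h.symm⟩ ∨ k = ⟨1, fun h => hj1 h.symm⟩ := by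
      intro k hk
      have hkj' : k.1.val ≠ j.val := fun h => k.2 (Fin.ext h)
      have hkkc : k.1.val ≠ kc.1.val := fun h => hk (Subtype.ext (Fin.ext h))
      have hkc0' : kc.1.val ≠ 0 := fun h => hkc0 (Fin.ext h)
      have hkc1' : kc.1.val ≠ 1 := fun h => hkc1 (Fin.ext h)
      have hkcj : kc.1.val ≠ j.val := fun h => kc.2 (Fin.ext h)
      have hj0' : j.val ≠ 0 := fun h => hj0 (Fin.ext h)
      have hj1' : j.val ≠ 1 := fun h => hj1 (Fin.ext h)
      have := k.1.isLt
      have := kc.1.isLt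
      have := j.isLt
      have h01 : k.1.val = 0 ∨ k.1.val = 1 := by omega
      rcases h01 with h01 | h01
      · exact Or.inl (Subtype.ext (Fin.ext h01))
      · exact Or.inr (Subtype.ext (Fin.ext h01))
    have hcj𝔔 : algebraMap R (blowupAlgebra (Ideal.span (Set.range c)) (c j)) (c j) ∈ 𝔔.asIdeal := by
      have : c j ∈ 𝔔.asIdeal.comap (algebraMap R (blowupAlgebra (Ideal.span (Set.range c)) (c j))) := by
        rw [h𝔔, ← hc]; exact Ideal.subset_span (Set.mem_range_self j)
      exact this
    -- (brick 17a states the restriction with the classical `Decidable` instances)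
    have h0' : MvPolynomial.aeval (fun k : {k : Fin 4 // k ≠ j} =>
        @ite (Polynomial (ResidueField R)) (k = kc) (Classical.propDecidable (k = kc)) Polynomial.X 0)
          (π (MvPolynomial.aeval (blowupAlgebra.frac c j) F)) = 0 := by
      have hfun : (fun k : {k : Fin 4 // k ≠ j} =>
          @ite (Polynomial (ResidueField R)) (k = kc) (Classical.propDecidable (k = kc)) Polynomial.X 0) =
            fun k : {k : Fin 4 // k ≠ j} => if k = kc then (Polynomial.X : Polynomial (ResidueField R)) else 0 := by
        funext k
        congr
      rw [hfun]
      exact h0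
    -- brick 17a: the prime `𝔮 = (u, v, c_j)` of the exceptional line, `h′ ∈ 𝔮²`
    obtain ⟨𝔮, h𝔮p, -, -, -, -, hh'𝔮, h𝔮le⟩ :=
      E2Chart.exists_prime_of_lineRestriction_eq_zero π hπsurj ha hb hab (hπfrac 0 fun h => hj0 h.symm)
        (hπfrac 1 fun h => hj1 h.symm) hπcj hkerπ.le heq h0'
    haveI := h𝔮p
    have h𝔮𝔔 : 𝔮 ≤ 𝔔.asIdeal := by
      refine h𝔮le.trans ?_
      rw [Ideal.span_le]
      intro x hx
      simp only [Set.mem_insert_iff, Set.mem_singleton_iff] at hx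
      rcases hx with rfl | rfl | rfl
      exacts [hfr0, hfr1, hcj𝔔]
    -- its extension to `B_𝔔`: a prime `≠ 𝔪` with `h′/1` in its square
    have hdisj : Disjoint (𝔔.asIdeal.primeCompl : Set (blowupAlgebra (Ideal.span (Set.range c)) (c j))) 𝔮 :=
      Set.disjoint_left.mpr fun z hz hz' => hz (h𝔮𝔔 hz')
    haveI hPL : (𝔮.map (algebraMap (blowupAlgebra (Ideal.span (Set.range c)) (c j)) (Localization.AtPrime 𝔔.asIdeal))).IsPrime :=
      IsLocalization.isPrime_of_isPrime_disjoint 𝔔.asIdeal.primeCompl (Localization.AtPrime 𝔔.asIdeal) 𝔮 h𝔮p hdisj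
    have hmemL : ∀ {z : blowupAlgebra (Ideal.span (Set.range c)) (c j)}, z ∈ 𝔔.asIdeal →
        algebraMap (blowupAlgebra (Ideal.span (Set.range c)) (c j)) (Localization.AtPrime 𝔔.asIdeal) z ∈
          maximalIdeal (Localization.AtPrime 𝔔.asIdeal) :=
      fun {z} hz => (IsLocalization.AtPrime.to_map_mem_maximal_iff (Localization.AtPrime 𝔔.asIdeal) 𝔔.asIdeal z).mpr hz
    have hspan : (Ideal.span {blowupAlgebra.frac c j 0, blowupAlgebra.frac c j 1,
        algebraMap R (blowupAlgebra (Ideal.span (Set.range c)) (c j)) (c j)}).map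
          (algebraMap (blowupAlgebra (Ideal.span (Set.range c)) (c j)) (Localization.AtPrime 𝔔.asIdeal)) ≤
        maximalIdeal (Localization.AtPrime 𝔔.asIdeal) := by
      rw [Ideal.map_le_iff_le_comap, Ideal.span_le]
      intro x hx
      simp only [Set.mem_insert_iff, Set.mem_singleton_iff] at hx
      rw [SetLike.mem_coe, Ideal.mem_comap]
      rcases hx with rfl | rfl | rfl
      exacts [hmemL hfr0, hmemL hfr1, hmemL hcj𝔔]
    have hPLne : 𝔮.map (algebraMap (blowupAlgebra (Ideal.span (Set.range c)) (c j)) (Localization.AtPrime 𝔔.asIdeal)) ≠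
        maximalIdeal (Localization.AtPrime 𝔔.asIdeal) := by
      intro hEq
      have hEq' : (Ideal.span {blowupAlgebra.frac c j 0, blowupAlgebra.frac c j 1,
          algebraMap R (blowupAlgebra (Ideal.span (Set.range c)) (c j)) (c j)}).map
            (algebraMap (blowupAlgebra (Ideal.span (Set.range c)) (c j)) (Localization.AtPrime 𝔔.asIdeal)) =
          maximalIdeal (Localization.AtPrime 𝔔.asIdeal) :=
        le_antisymm hspan (hEq ▸ Ideal.map_mono h𝔮le)
      have h3 : (maximalIdeal (Localization.AtPrime 𝔔.asIdeal)).spanFinrank ≤ 3 := by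
        rw [← hEq', Ideal.map_span]
        refine (Submodule.spanFinrank_span_le_ncard_of_finite ((Set.toFinite _).image _)).trans ?_
        refine (Set.ncard_image_le (Set.toFinite _)).trans ?_
        refine (Set.ncard_insert_le _ _).trans ?_
        have := Set.ncard_insert_le (blowupAlgebra.frac c j 1)
          ({algebraMap R (blowupAlgebra (Ideal.span (Set.range c)) (c j)) (c j)} : Set (blowupAlgebra (Ideal.span (Set.range c)) (c j)))
        rw [Set.ncard_singleton] at this
        omega
      omega
    have hgP : algebraMap (blowupAlgebra (Ideal.span (Set.range c)) (c j)) (Localization.AtPrime 𝔔.asIdeal) h' ∈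
        𝔮.map (algebraMap (blowupAlgebra (Ideal.span (Set.range c)) (c j)) (Localization.AtPrime 𝔔.asIdeal)) ^ 2 := by
      rw [← Ideal.map_pow]
      exact Ideal.mem_map_of_mem _ hh'𝔮
    -- `dim X_{n+1} ≤ N`, so `N ≥ 3`
    have hN3 : 3 ≤ N := by
      have hle := IsoTailsHS.ringKrullDim_stalk_le T hO.dim_le (n + 1) (pt (n + 1))
      rw [hdim3] at hle
      exact_mod_cast hle
    -- brick 17a: the next point would not be isolated in the Hilbert–Samuel locus of `X_{n+1}`
    exact @not_isIsolatedInHSMaxLocus_of_mem_prime_sq (T.X (n + 1)) _ (pt (n + 1)) N 4 (Localization.AtPrime 𝔔.asIdeal) _ hregL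
      hL4 (by omega) σ' hσ' _ hker' hh'2 hh'3 _ hPL hPLne hgP (hT.2.2.2.2.1 (n + 1))
  -- RC: `deg P = 1`
  have hdeg : P.natDegree = 1 := by
    refine E2Chart.natDegree_generator_eq_one ?_ hg0 hdeg3 hdiv1 hdiv2
    rw [← hP]; exact Ideal.comap_isPrime _ 𝔭
  exact ⟨R, inferInstance, inferInstance, c, σ, h, cc, lam, hpt, h4, hc, hσ, hker, hh2, hh3, hcc, hlam, hshape, h2, j, 𝔔, h', σ',
    hh', hprime, hndvd, h𝔔, hh'𝔔, hreg, hσ', hker', hcompat, hfrac, hnzd, hcentre, hh'2, hh'3, hfr0, hfr1, hj0, hj1,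
    ⟨F, hF, hFh, heq, hG, hG0, π, 𝔭, h𝔭p, kc, P, hπsurj, hπalg, hπfrac, hkerπ, h𝔭, hcomap, ⟨hkc0, hkc1⟩, hvars, hP, hπG𝔭, hsym,
      hdiv1, hdiv2, hg0, hdeg⟩⟩

end Summit.ResolutionOfSingularities.ResolutionOfSingularities.Cruxes.SigmaMaxModifications.IdeasL1C6

end
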